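import Mathlib
import Summits.ResolutionOfSingularities.ResolutionOfSingularities.Theorems.RadicialJungCleanModelsBestApproxClean
import HarnessLib

/-!
# Route `RadicialJung`, crux `CleanModels` (stmt-15917), stub `stub_cleanLU3`: best `p`-th-power approximation —
# Laurent-monomial remainders

Line `Sketch` rev 16 of crux stmt-ResolutionOfSingularities-15917 (memo `Cruxes/CleanModels/Lines/Sketch-memo-open-stubs.md` §2).
OURS; nothing here proves resolution in characteristic `p`.

Embedded resolution monomializes numerator and denominator of the remainder `g₀ - f₀^p` separately, so the remainder is a
unit times a LAURENT monomial `∏ tᵢ^{aᵢ}`, `aᵢ ∈ ℤ`, in a regular system of parameters.  This file extends the read-off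
`cleanRegAt_of_isMin_pthPowerApprox` (✓ `…BestApproxClean`) to integer exponents, by twisting `g₀ ↦ g₀ · H^p`
(`H = ∏ tᵢ^{|aᵢ|}`), which preserves both the best-approximation property and `CleanRegAt` (`CleanRegAt.of_mul_pow`).
-/

noncomputable section

set_option linter.dupNamespace false -- mandated namespace of this single-conjunct summit

open IsLocalRing
open Literature.AlgebraicGeometry.Resolution

namespace Summit.ResolutionOfSingularities.ResolutionOfSingularities.Theorems.RadicialJung.CleanModels

variable {p : ℕ}

/-- **Untwisting.** `CleanRegAt` for `g₀ · H^p` (`H ≠ 0`) gives `CleanRegAt` for `g₀`: `Σ c_j^p (g₀ H^p)^j = Σ (c_j H^j)^p g₀^j`.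
[folklore] -/
theorem CleanRegAt.of_mul_pow {R F : Type*} [CommRing R] [Field F] (f : R →+* F) (g₀ H : F) (hH : H ≠ 0)
    (h : CleanRegAt p f (g₀ * H ^ p)) : CleanRegAt p f g₀ := by
  obtain ⟨hR, c, ⟨j, hj, hcj⟩, hform⟩ := h
  refine ⟨hR, fun i => c i * H ^ (i : ℕ), ⟨j, hj, mul_ne_zero hcj (pow_ne_zero _ hH)⟩, ?_⟩
  have hsum : (∑ i : Fin p, (c i * H ^ (i : ℕ)) ^ p * g₀ ^ (i : ℕ)) = ∑ i : Fin p, c i ^ p * (g₀ * H ^ p) ^ (i : ℕ) :=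
    Finset.sum_congr rfl fun i _ => by rw [mul_pow, mul_pow, ← pow_mul, ← pow_mul, mul_comm p]; ring
  rw [hsum]
  exact hform

variable [hp : Fact p.Prime] {K : Type} [Field K] [CharP K p]

/-- **Cleanness from a best `p`-th-power approximation with a Laurent-monomial remainder** (integer exponents): the
`ℤ`-version of `cleanRegAt_of_isMin_pthPowerApprox`. [folklore] -/
theorem cleanRegAt_of_isMin_pthPowerApprox_zpow (O : ValuationSubring K) (R : Subring K) [IsRegularLocalRing R]
    (hRO : R ≤ O.toSubring) (hdom : ∀ x : R, x ∈ maximalIdeal R → O.valuation (x : K) < 1)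
    (g₀ f₀ : K) (hmin : ∀ f : K, O.valuation (g₀ - f₀ ^ p) ≤ O.valuation (g₀ - f ^ p))
    {d : ℕ} (t : Fin d → R) (ht : Ideal.span (Set.range t) = maximalIdeal R) (hd : ringKrullDim R = d)
    (ht0 : ∀ i, (t i : K) ≠ 0) (a : Fin d → ℤ) (u : R) (hu : IsUnit u)
    (hG : g₀ - f₀ ^ p = (u : K) * ∏ i, (t i : K) ^ (a i)) :
    CleanRegAt p R.subtype g₀ := by
  -- twist by `H = ∏ tᵢ^{|aᵢ|}`
  let H : K := ∏ i, (t i : K) ^ (a i).natAbs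
  have hH : H ≠ 0 := Finset.prod_ne_zero_iff.mpr fun i _ => pow_ne_zero _ (ht0 i)
  refine CleanRegAt.of_mul_pow R.subtype g₀ H hH ?_
  -- the twisted data: natural exponents `aᵢ + p |aᵢ| ≥ 0`
  let b : Fin d → ℕ := fun i => (a i + p * (a i).natAbs).toNat
  have hb : ∀ i, ((b i : ℕ) : ℤ) = a i + p * (a i).natAbs := by
    intro i
    simp only [b]
    refine Int.toNat_of_nonneg ?_
    have h1 : -(a i) ≤ ((a i).natAbs : ℤ) := by
      rw [← Int.natAbs_neg]; exact Int.le_natAbs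
    have h2 : ((a i).natAbs : ℤ) ≤ p * (a i).natAbs := le_mul_of_one_le_left (by positivity) (by exact_mod_cast hp.out.one_lt.le)
    linarith
  have hmin' : ∀ f : K, O.valuation (g₀ * H ^ p - (f₀ * H) ^ p) ≤ O.valuation (g₀ * H ^ p - f ^ p) := by
    intro f
    have h1 : g₀ * H ^ p - (f₀ * H) ^ p = H ^ p * (g₀ - f₀ ^ p) := by ring
    have h2 : g₀ * H ^ p - f ^ p = H ^ p * (g₀ - (f / H) ^ p) := by
      rw [div_pow, mul_sub, mul_div_cancel₀ _ (pow_ne_zero _ hH)]; ring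
    rw [h1, h2, map_mul, map_mul]
    exact mul_le_mul_right (hmin (f / H)) _
  have hG' : g₀ * H ^ p - (f₀ * H) ^ p = (u : K) * ∏ i, (t i : K) ^ b i := by
    have h1 : g₀ * H ^ p - (f₀ * H) ^ p = H ^ p * (g₀ - f₀ ^ p) := by ring
    rw [h1, hG, mul_left_comm]
    congr 1
    simp only [H, ← Finset.prod_pow, ← Finset.prod_mul_distrib]
    refine Finset.prod_congr rfl fun i _ => ?_
    have e1 : ((t i : K) ^ (a i).natAbs) ^ p = (t i : K) ^ ((p : ℤ) * (a i).natAbs) := by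
      rw [← pow_mul, ← zpow_natCast]; congr 1; push_cast; ring
    rw [e1, ← zpow_add₀ (ht0 i), ← zpow_natCast (t i : K) (b i), hb i, add_comm]
  exact cleanRegAt_of_isMin_pthPowerApprox O R hRO hdom (g₀ * H ^ p) (f₀ * H) hmin' t ht hd b u hu hG'

end Summit.ResolutionOfSingularities.ResolutionOfSingularities.Theorems.RadicialJung.CleanModels

end
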